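import Summits.KontsevichZagierPeriods.KontsevichZagierPeriods.Theorems.FurushoPentagonDoubleShuffleInKZRiderLever
import Summits.KontsevichZagierPeriods.KontsevichZagierPeriods.Theorems.FurushoPentagonDoubleShuffleInKZDilationSlotSemialg
import Summits.KontsevichZagierPeriods.KontsevichZagierPeriods.Theorems.FurushoPentagonDoubleShuffleInKZRiderDissection

/-!
# `DoubleShuffleInKZ` (stmt-KontsevichZagierPeriods-14665, route `FurushoPentagon`): one rider step

Helper file (`--supports stmt-KontsevichZagierPeriods-14665`), line "rider lever" for the
Kaneko–Yamamoto integral–series family `IS_j(u)`.  THE INDUCTIVE STEP of the line (`rider_step`):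
for a non-empty admissible `w` (weight `n`, depth `k`), a block `m < k` and a family `C` pinned to the
mixed representations with `j` riders (`rider_dissection`), the mixed representation with `j + 1`
riders
`C_{j+1}(w, m) = [{x ∈ (0,1)ⁿ, 0 < v₀ < ⋯ < v_j < 1, v_j < x_q}, f_w(x) · ∏_{a ≤ j} 1/(1 − v_a)]`
(`q = p_m`; series shadow `Σ n^{-w} S_{j+1}(n_{m+1})`) EXISTS and is congruent modulo `KZ.relations`
to `Σ_{m ≤ i < k} (C(raise_i w, i) + C(ins_i w, i+1))` (series shadow
`S_{j+1}(N) = Σ_{N' ≤ N} S_j(N')/N'`, the new summation variable placed at or below block `m`):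
the rider lever `rider_lever` at the active coordinate `x_q` with floor `v_j` (its calculus fed by
`update_mul_hasDerivAt`, `update_mul_continuousOn`, `update_nonneg`, `slotBox_isSemialgebraicFunOn`),
whose END representation is the one dissected by `rider_dissection`.

References: M. Kontsevich, D. Zagier, *Periods* (2001), §1.2; M. E. Hoffman, Pacific J. Math. 152
(1992), Thm 5.1; M. Kaneko, S. Yamamoto, Selecta Math. 24 (2018), Thm 4.1.
-/

noncomputable section

open Set MeasureTheory Function
open Literature.NumberTheory.Transcendental
open Literature.ModelTheory.ExponentialFields (IsSemialgebraic)
open Summit.KontsevichZagierPeriods.FurushoPentagon.HoffmanRelationInKZ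

namespace Summit.KontsevichZagierPeriods.FurushoPentagon.DoubleShuffleInKZ

/-! ### The passive domain and its semialgebraicity -/

/-- The passive cylinder `{x_i ∈ (0,1) (i ≠ q), 0 < v₀ < ⋯ < v_J-1 < 1}` (no condition on `x_q`)
is `ℚ`-semialgebraic. [folklore] -/
theorem isSemialgebraic_passiveDomain (J n q : ℕ) :
    IsSemialgebraic ℚ {z : Fin (J + n) → ℝ |
      (∀ i : Fin n, (i : ℕ) ≠ q → z (Fin.natAdd J i) ∈ Set.Ioo (0:ℝ) 1) ∧
      (∀ a : Fin J, z (Fin.castAdd n a) ∈ Set.Ioo (0:ℝ) 1) ∧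
      (∀ a b : Fin J, a < b → z (Fin.castAdd n a) < z (Fin.castAdd n b))} := by
  classical
  have h1 : IsSemialgebraic ℚ {z : Fin (J + n) → ℝ | ∀ k : Fin (J + n), (k : ℕ) ≠ J + q →
      0 < z k ∧ z k < 1} := by
    have : {z : Fin (J + n) → ℝ | ∀ k : Fin (J + n), (k : ℕ) ≠ J + q → 0 < z k ∧ z k < 1} =
        ⋂ k ∈ (Finset.univ.filter fun k : Fin (J + n) => (k : ℕ) ≠ J + q),
          ({z | 0 < MvPolynomial.aeval z (MvPolynomial.X k : MvPolynomial (Fin (J + n)) ℚ)} ∩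
           {z | 0 < MvPolynomial.aeval z
             (MvPolynomial.C 1 - MvPolynomial.X k : MvPolynomial (Fin (J + n)) ℚ)}) := by
      ext z; simp [sub_pos]
    rw [this]
    exact Literature.ModelTheory.ExponentialFields.IsSemialgebraic.biInter _ _ fun k _ =>
      (Literature.ModelTheory.ExponentialFields.isSemialgebraic_setOf_eval_pos _).inter
        (Literature.ModelTheory.ExponentialFields.isSemialgebraic_setOf_eval_pos _)
  have h2 : IsSemialgebraic ℚ
      {z : Fin (J + n) → ℝ | ∀ a b : Fin J, a < b → z (Fin.castAdd n a) < z (Fin.castAdd n b)} := by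
    have : {z : Fin (J + n) → ℝ | ∀ a b : Fin J, a < b → z (Fin.castAdd n a) < z (Fin.castAdd n b)} =
        ⋂ a ∈ (Finset.univ : Finset (Fin J)), ⋂ b ∈ (Finset.univ : Finset (Fin J)),
          (if a < b then {z | 0 < MvPolynomial.aeval z
            (MvPolynomial.X (Fin.castAdd n b) - MvPolynomial.X (Fin.castAdd n a) :
              MvPolynomial (Fin (J + n)) ℚ)} else Set.univ) := by
      ext z
      simp only [Set.mem_setOf_eq, Finset.mem_univ, Set.iInter_true, Set.mem_iInter]
      constructor
      · intro h a b
        split_ifs with hab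
        · simpa [sub_pos] using h a b hab
        · trivial
      · intro h a b hab
        have := h a b
        rw [if_pos hab] at this
        simpa [sub_pos] using this
    rw [this]
    refine Literature.ModelTheory.ExponentialFields.IsSemialgebraic.biInter _ _ fun a _ =>
      Literature.ModelTheory.ExponentialFields.IsSemialgebraic.biInter _ _ fun b _ => ?_
    split_ifs
    · exact Literature.ModelTheory.ExponentialFields.isSemialgebraic_setOf_eval_pos _
    · exact Literature.ModelTheory.ExponentialFields.isSemialgebraic_univ
  convert h1.inter h2 using 1
  ext z
  simp only [Set.mem_setOf_eq, Set.mem_inter_iff, Set.mem_Ioo]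
  constructor
  · rintro ⟨hx, hv, hmono⟩
    refine ⟨fun k hk => ?_, hmono⟩
    induction k using Fin.addCases with
    | left a => exact hv a
    | right i => exact hx i (fun h => hk (by simp [h]))
  · rintro ⟨h, hmono⟩
    refine ⟨fun i hi => h _ (fun h' => hi (by simpa using h')), fun a => h _ (fun h' => ?_), hmono⟩
    have := a.2
    simp at h'
    omega

/-! ### Coordinates: the cubical block of an updated point -/

/-- Reading the cubical block commutes with updating a cubical coordinate. [folklore] -/
theorem block_update {J n : ℕ} (z : Fin (J + n) → ℝ) (i : Fin n) (b : ℝ) :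
    (fun t : Fin n => update z (Fin.natAdd J i) b (Fin.natAdd J t)) =
      update (fun t : Fin n => z (Fin.natAdd J t)) i b := by
  funext t
  by_cases h : t = i
  · subst h; simp
  · have hne : (Fin.natAdd J t : Fin (J + n)) ≠ Fin.natAdd J i := fun h' =>
      h (Fin.ext (by simpa using congrArg Fin.val h'))
    rw [update_of_ne h, update_of_ne hne]

/-- Updating a cubical coordinate does not touch the riders. [folklore] -/
theorem rider_update {J n : ℕ} (z : Fin (J + n) → ℝ) (i : Fin n) (b : ℝ) (a : Fin J) :
    update z (Fin.natAdd J i) b (Fin.castAdd n a) = z (Fin.castAdd n a) := by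
  rw [update_of_ne]
  intro h
  have := congrArg Fin.val h
  simp at this
  omega

/-! ### The step -/

/-- **One rider step** (`C_{j+1}(w, m) ≡ Σ_{m ≤ i < k} (C_j(raise_i w, i) + C_j(ins_i w, i+1))`).
For a non-empty admissible `w` (weight `n`, depth `k`), a block `m < k` with first slot `q = p_m`, and
a family `C` pinned to the mixed representations with `j` riders: the mixed representation with
`j + 1` riders `[{x ∈ (0,1)ⁿ, 0 < v₀ < ⋯ < v_j < 1, v_j < x_q}, f_w(x) ∏_{a ≤ j} 1/(1 − v_a)]` exists and
every representation of that shape is congruent modulo `KZ.relations` to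
`Σ_{m ≤ i < k} (C(raise_i w, i) + C(ins_i w, i + 1))`: the rider lever (`rider_lever`, active
coordinate `x_q`, floor `v_j`, passive riders `v₀,…,v_{j-1}`; Euler homogeneity of `f_w` at the slot
`q`, `update_mul_hasDerivAt`) followed by the rider dissection of its END representation
(`rider_dissection`). [cite: KontsevichZagier2001, §1.2] -/
theorem rider_step (w : List ℕ) (hw : MZV.IsAdmissible w) (hne : w ≠ []) {m : ℕ}
    (hm : m < w.length) (j : ℕ) (C : List ℕ → ℕ → KZ.FormalRep)
    (hC : ∀ (w' : List ℕ), MZV.IsAdmissible w' → w' ≠ [] → ∀ (m' : ℕ), m' < w'.length →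
      ∃ r : KZ.IntegralRep (j + MZV.weight w'),
        r.domain = {z : Fin (j + MZV.weight w') → ℝ |
          (∀ i : Fin (MZV.weight w'), z (Fin.natAdd j i) ∈ Set.Ioo (0:ℝ) 1) ∧
          (∀ a : Fin j, z (Fin.castAdd (MZV.weight w') a) ∈ Set.Ioo (0:ℝ) 1) ∧
          (∀ a b : Fin j, a < b → z (Fin.castAdd (MZV.weight w') a) < z (Fin.castAdd (MZV.weight w') b)) ∧
          (∀ a : Fin j, (a : ℕ) + 1 = j → ∀ i : Fin (MZV.weight w'), (i : ℕ) = (w'.take m').sum →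
            z (Fin.castAdd (MZV.weight w') a) < z (Fin.natAdd j i))} ∧
        Set.EqOn r.integrand (fun z => (∏ l : Fin w'.length,
          (∏ t : Fin (MZV.weight w'), if (t : ℕ) < (w'.take l).sum then z (Fin.natAdd j t) else 1) /
          (1 - (∏ t : Fin (MZV.weight w'),
            if (t : ℕ) < (w'.take ((l : ℕ) + 1)).sum then z (Fin.natAdd j t) else 1))) *
          ∏ a : Fin j, 1 / (1 - z (Fin.castAdd (MZV.weight w') a))) r.domain ∧
        C w' m' = KZ.of r) :
    (∃ r : KZ.IntegralRep ((j + 1) + MZV.weight w),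
      r.domain = {z : Fin ((j + 1) + MZV.weight w) → ℝ |
        (∀ i : Fin (MZV.weight w), z (Fin.natAdd (j + 1) i) ∈ Set.Ioo (0:ℝ) 1) ∧
        (∀ a : Fin (j + 1), z (Fin.castAdd (MZV.weight w) a) ∈ Set.Ioo (0:ℝ) 1) ∧
        (∀ a b : Fin (j + 1), a < b → z (Fin.castAdd (MZV.weight w) a) < z (Fin.castAdd (MZV.weight w) b)) ∧
        (∀ a : Fin (j + 1), (a : ℕ) + 1 = j + 1 → ∀ i : Fin (MZV.weight w), (i : ℕ) = (w.take m).sum →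
          z (Fin.castAdd (MZV.weight w) a) < z (Fin.natAdd (j + 1) i))} ∧
      Set.EqOn r.integrand (fun z => (∏ l : Fin w.length,
        (∏ t : Fin (MZV.weight w), if (t : ℕ) < (w.take l).sum then z (Fin.natAdd (j + 1) t) else 1) /
        (1 - (∏ t : Fin (MZV.weight w),
          if (t : ℕ) < (w.take ((l : ℕ) + 1)).sum then z (Fin.natAdd (j + 1) t) else 1))) *
        ∏ a : Fin (j + 1), 1 / (1 - z (Fin.castAdd (MZV.weight w) a))) r.domain) ∧
    ∀ r : KZ.IntegralRep ((j + 1) + MZV.weight w),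
      r.domain = {z : Fin ((j + 1) + MZV.weight w) → ℝ |
        (∀ i : Fin (MZV.weight w), z (Fin.natAdd (j + 1) i) ∈ Set.Ioo (0:ℝ) 1) ∧
        (∀ a : Fin (j + 1), z (Fin.castAdd (MZV.weight w) a) ∈ Set.Ioo (0:ℝ) 1) ∧
        (∀ a b : Fin (j + 1), a < b → z (Fin.castAdd (MZV.weight w) a) < z (Fin.castAdd (MZV.weight w) b)) ∧
        (∀ a : Fin (j + 1), (a : ℕ) + 1 = j + 1 → ∀ i : Fin (MZV.weight w), (i : ℕ) = (w.take m).sum →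
          z (Fin.castAdd (MZV.weight w) a) < z (Fin.natAdd (j + 1) i))} →
      Set.EqOn r.integrand (fun z => (∏ l : Fin w.length,
        (∏ t : Fin (MZV.weight w), if (t : ℕ) < (w.take l).sum then z (Fin.natAdd (j + 1) t) else 1) /
        (1 - (∏ t : Fin (MZV.weight w),
          if (t : ℕ) < (w.take ((l : ℕ) + 1)).sum then z (Fin.natAdd (j + 1) t) else 1))) *
        ∏ a : Fin (j + 1), 1 / (1 - z (Fin.castAdd (MZV.weight w) a))) r.domain →
      KZ.of r - ∑ i ∈ Finset.Ico m w.length,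
        (C (w.take i ++ [w.getD i 0 + 1] ++ w.drop (i + 1)) i +
          C (w.take (i + 1) ++ [1] ++ w.drop (i + 1)) (i + 1)) ∈ KZ.relations := by
  -- ### the objects, by defining equations
  let T : ℕ → (Fin (MZV.weight w) → ℝ) → ℝ := fun r x => ∏ t : Fin (MZV.weight w),
    if (t : ℕ) < r then x t else 1
  have hT : ∀ r x, T r x = ∏ t : Fin (MZV.weight w), if (t : ℕ) < r then x t else 1 := fun _ _ => rfl
  let S : ℕ → (Fin (MZV.weight w) → ℝ) → ℝ := fun r x => ∏ t : Fin (MZV.weight w),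
    if (t : ℕ) < r ∧ (t : ℕ) ≠ (w.take m).sum then x t else 1
  let p : ℕ → ℕ := fun l => (w.take l).sum
  let F : (Fin (MZV.weight w) → ℝ) → ℝ := fun x => ∏ l : Fin w.length, T (p l) x / (1 - T (p (l + 1)) x)
  have hF : ∀ x, F x = ∏ l : Fin w.length, T (p l) x / (1 - T (p (l + 1)) x) := fun _ => rfl
  have hF' : ∀ x, F x = ∏ l : Fin w.length, (∏ t : Fin (MZV.weight w),
      if (t : ℕ) < (w.take l).sum then x t else 1) / (1 - (∏ t : Fin (MZV.weight w),
      if (t : ℕ) < (w.take ((l : ℕ) + 1)).sum then x t else 1)) := fun _ => rfl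
  let K : (Fin (MZV.weight w) → ℝ) → ℝ := fun x => F x * ∑ l : Fin w.length,
    if m ≤ (l : ℕ) then 1 / (1 - T (p (l + 1)) x) else 0
  have hK : ∀ x, K x = F x * ∑ l : Fin w.length, if m ≤ (l : ℕ) then 1 / (1 - T (p (l + 1)) x) else 0 :=
    fun _ => rfl
  let σ : ℝ → (Fin (MZV.weight w) → ℝ) → (Fin (MZV.weight w) → ℝ) := fun c x t =>
    if (t : ℕ) = (w.take m).sum then c * x t else x t
  have hσ : ∀ c x t, σ c x t = if (t : ℕ) = (w.take m).sum then c * x t else x t := fun _ _ _ => rfl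
  -- ### numerics of the index
  have hk : 0 < w.length := List.length_pos_of_ne_nil hne
  have hmono : ∀ l l' : ℕ, l < l' → l' ≤ w.length → p l < p l' := by
    intro l l' hll' hl'
    have h1 : (w.take l).sum < (w.take (l + 1)).sum := by
      rw [← List.take_append_getElem (show l < w.length by omega), List.sum_append, List.sum_singleton]
      have : 1 ≤ w[l] := hw.1 _ (List.getElem_mem _)
      omega
    exact lt_of_lt_of_le h1 (sum_take_mono w (by omega))
  have hp2 : ∀ l, 1 ≤ l → 2 ≤ p l := by
    intro l hl
    obtain ⟨b, t, rfl⟩ := List.exists_cons_of_ne_nil hne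
    obtain ⟨l, rfl⟩ : ∃ l', l = l' + 1 := ⟨l - 1, by omega⟩
    show 2 ≤ ((b :: t).take (l + 1)).sum
    rw [List.take_succ_cons, List.sum_cons]
    have : 2 ≤ b := hw.2 (List.cons_ne_nil b t)
    omega
  have hq : (w.take m).sum < MZV.weight w := by
    have := hmono m w.length hm le_rfl
    simpa [p, MZV.weight] using this
  have hN : 2 ≤ MZV.weight w := le_trans (hp2 w.length hk) (by simp [p, MZV.weight])
  set q : Fin (MZV.weight w) := ⟨(w.take m).sum, hq⟩ with hq_def
  have hpm : p m = q := rfl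
  have hS : ∀ r x, S r x = ∏ t : Fin (MZV.weight w), if (t : ℕ) < r ∧ (t : ℕ) ≠ q then x t else 1 :=
    fun _ _ => rfl
  -- ### the rider dissection: the END representation exists and dissects
  obtain ⟨⟨rE, hrEd, hrEi⟩, hdis⟩ := rider_dissection w hw hne hm j F σ hF' hσ C hC
  -- ### the data of the rider lever
  let i₀ : Fin ((j + 1) + MZV.weight w) := Fin.natAdd (j + 1) q
  let P : Set (Fin ((j + 1) + MZV.weight w) → ℝ) := {z |
    (∀ i : Fin (MZV.weight w), (i : ℕ) ≠ (w.take m).sum → z (Fin.natAdd (j + 1) i) ∈ Set.Ioo (0:ℝ) 1) ∧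
    (∀ a : Fin (j + 1), z (Fin.castAdd (MZV.weight w) a) ∈ Set.Ioo (0:ℝ) 1) ∧
    (∀ a b : Fin (j + 1), a < b → z (Fin.castAdd (MZV.weight w) a) < z (Fin.castAdd (MZV.weight w) b))}
  have hPsa : IsSemialgebraic ℚ P := isSemialgebraic_passiveDomain (j + 1) (MZV.weight w) (w.take m).sum
  let xz : (Fin ((j + 1) + MZV.weight w) → ℝ) → (Fin (MZV.weight w) → ℝ) :=
    fun z t => z (Fin.natAdd (j + 1) t)
  let Rz : (Fin ((j + 1) + MZV.weight w) → ℝ) → ℝ :=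
    fun z => ∏ a : Fin (j + 1), 1 / (1 - z (Fin.castAdd (MZV.weight w) a))
  let c : (Fin ((j + 1) + MZV.weight w) → ℝ) → ℝ := fun z => z (Fin.castAdd (MZV.weight w) (Fin.last j))
  let f : (Fin ((j + 1) + MZV.weight w) → ℝ) → ℝ := fun z => F (xz z) * Rz z
  let kk : (Fin ((j + 1) + MZV.weight w) → ℝ) → ℝ := fun z => K (xz z) * Rz z
  -- updates in the active coordinate
  have hxupd : ∀ (z : Fin ((j + 1) + MZV.weight w) → ℝ) (b : ℝ), xz (update z i₀ b) = update (xz z) q b :=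
    fun z b => block_update z q b
  have hRupd : ∀ (z : Fin ((j + 1) + MZV.weight w) → ℝ) (b : ℝ), Rz (update z i₀ b) = Rz z :=
    fun z b => Finset.prod_congr rfl fun a _ => by rw [rider_update]
  have hcupd : ∀ (z : Fin ((j + 1) + MZV.weight w) → ℝ) (b : ℝ), c (update z i₀ b) = c z :=
    fun z b => rider_update z q b (Fin.last j)
  have hi₀ : ∀ z : Fin ((j + 1) + MZV.weight w) → ℝ, z i₀ = xz z q := fun _ => rfl
  have hPupd : ∀ z ∈ P, ∀ b : ℝ, update z i₀ b ∈ P := by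
    intro z hz b
    refine ⟨fun i hi => ?_, fun a => ?_, fun a b' hab => ?_⟩
    · have hne' : (Fin.natAdd (j + 1) i : Fin ((j + 1) + MZV.weight w)) ≠ i₀ := fun h' =>
        hi (by simpa [i₀, hq_def] using congrArg Fin.val h')
      rw [update_of_ne hne']
      exact hz.1 i hi
    · rw [rider_update]; exact hz.2.1 a
    · rw [rider_update, rider_update]; exact hz.2.2 a b' hab
  have hcsa : IsSemialgebraicFunOn ℚ P c := isSemialgebraicFunOn_apply hPsa _
  have hc : ∀ z ∈ P, c z ∈ Set.Ioo (0:ℝ) 1 := fun z hz => hz.2.1 (Fin.last j)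
  -- the box `B₀ = {z ∈ P | 0 ≤ z i₀ < 1}` and semialgebraicity of `f`, `kk` there
  set B₀ : Set (Fin ((j + 1) + MZV.weight w) → ℝ) := {z | z ∈ P ∧ z i₀ ∈ Set.Ico (0:ℝ) 1} with hB₀_def
  have hB₀sa : IsSemialgebraic ℚ B₀ := by
    have hnn : IsSemialgebraic ℚ {z : Fin ((j + 1) + MZV.weight w) → ℝ | 0 ≤ z i₀} := by
      simpa using Literature.ModelTheory.ExponentialFields.isSemialgebraic_setOf_eval_le
        (k := ℚ) (R := ℝ) (0 : MvPolynomial (Fin ((j + 1) + MZV.weight w)) ℚ) (MvPolynomial.X i₀)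
    have hlt1 : IsSemialgebraic ℚ {z : Fin ((j + 1) + MZV.weight w) → ℝ | z i₀ < 1} := by
      simpa using Literature.ModelTheory.ExponentialFields.isSemialgebraic_setOf_eval_lt
        (k := ℚ) (R := ℝ) (MvPolynomial.X i₀ : MvPolynomial (Fin ((j + 1) + MZV.weight w)) ℚ) 1
    convert (hPsa.inter hnn).inter hlt1 using 1
    ext z; simp only [hB₀_def, mem_setOf_eq, mem_inter_iff, mem_Ico]; tauto
  have hxsa : IsSemialgebraicMapOn ℚ B₀ xz := by
    refine (isSemialgebraicMapOn_aeval hB₀sa (fun t => MvPolynomial.X (Fin.natAdd (j + 1) t))).congr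
      fun z _ => ?_
    funext t; simp [xz]
  have hmaps : MapsTo xz B₀ {x : Fin (MZV.weight w) → ℝ |
      (∀ i : Fin (MZV.weight w), (i : ℕ) ≠ q → x i ∈ Ioo (0:ℝ) 1) ∧ x q ∈ Ico (0:ℝ) 1} :=
    fun z hz => ⟨fun i hi => hz.1.1 i hi, hz.2⟩
  obtain ⟨hFbox, hKbox⟩ := slotBox_isSemialgebraicFunOn hN q T S hT hS p hp2 F K hF hK
  have hRsa : IsSemialgebraicFunOn ℚ B₀ Rz := by
    refine (isSemialgebraicFunOn_aeval_div_aeval hB₀sa (1 : MvPolynomial (Fin ((j + 1) + MZV.weight w)) ℚ)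
      (∏ a : Fin (j + 1), (1 - MvPolynomial.X (Fin.castAdd (MZV.weight w) a))) fun z hz => ?_).congr
      fun z hz => ?_
    · rw [map_prod]
      exact Finset.prod_ne_zero_iff.mpr fun a _ => by
        rw [map_sub, map_one, MvPolynomial.aeval_X]
        exact (sub_pos.mpr (hz.1.2.1 a).2).ne'
    · simp only [Rz, map_prod, map_sub, map_one, MvPolynomial.aeval_X]
      rw [Finset.prod_div_distrib, Finset.prod_const_one]
  have hfsa : IsSemialgebraicFunOn ℚ B₀ f :=
    IsSemialgebraicFunOn.mul_holds
      (IsSemialgebraicFunOn.comp_isSemialgebraicMapOn_holds hFbox hxsa hmaps) hRsa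
  have hksa : IsSemialgebraicFunOn ℚ B₀ kk :=
    IsSemialgebraicFunOn.mul_holds
      (IsSemialgebraicFunOn.comp_isSemialgebraicMapOn_holds hKbox hxsa hmaps) hRsa
  -- the dilation calculus along the active coordinate
  have hRpos : ∀ z ∈ P, 0 < Rz z := fun z hz =>
    Finset.prod_pos fun a _ => div_pos one_pos (sub_pos.mpr (hz.2.1 a).2)
  have hfun : ∀ (z : Fin ((j + 1) + MZV.weight w) → ℝ), (fun b : ℝ => b * f (update z i₀ b)) =
      fun b : ℝ => (b * F (update (xz z) q b)) * Rz z := by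
    intro z; funext b
    show b * (F (xz (update z i₀ b)) * Rz (update z i₀ b)) = _
    rw [hxupd, hRupd]; ring
  have hder : ∀ z ∈ P, ∀ b ∈ Ioo (0:ℝ) 1,
      HasDerivAt (fun b : ℝ => b * f (update z i₀ b)) (kk (update z i₀ b)) b := by
    intro z hz b hb
    have e : kk (update z i₀ b) = K (update (xz z) q b) * Rz z := by
      show K (xz (update z i₀ b)) * Rz (update z i₀ b) = _
      rw [hxupd, hRupd]
    rw [hfun z, e]
    exact (update_mul_hasDerivAt hN q T S hT hS p hmono hp2 hm hpm F K hF hK hz.1 hb).mul_const (Rz z)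
  have hcont : ∀ z ∈ P, ContinuousOn (fun b : ℝ => b * f (update z i₀ b)) (Ico 0 1) := by
    intro z hz
    rw [hfun z]
    exact ((update_mul_continuousOn hN q T S hT hS p hmono hp2 hm hpm F hF hz.1).mul
      continuousOn_const).mono Ico_subset_Icc_self
  have hk0 : ∀ z ∈ P, ∀ b ∈ Ioo (0:ℝ) 1, 0 ≤ kk (update z i₀ b) := by
    intro z hz b hb
    show 0 ≤ K (xz (update z i₀ b)) * Rz (update z i₀ b)
    rw [hxupd, hRupd]
    exact mul_nonneg (update_nonneg hN q T S hT hS p hp2 F K hF hK hz.1 ⟨hb.1.le, hb.2.le⟩).2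
      (hRpos z hz).le
  -- the three shape identities
  have hS1 : {z : Fin ((j + 1) + MZV.weight w) → ℝ |
        (∀ i : Fin (MZV.weight w), z (Fin.natAdd (j + 1) i) ∈ Set.Ioo (0:ℝ) 1) ∧
        (∀ a : Fin (j + 1), z (Fin.castAdd (MZV.weight w) a) ∈ Set.Ioo (0:ℝ) 1) ∧
        (∀ a b : Fin (j + 1), a < b → z (Fin.castAdd (MZV.weight w) a) < z (Fin.castAdd (MZV.weight w) b))} =
      {z | z ∈ P ∧ z i₀ ∈ Ioo (0:ℝ) 1} := by
    ext z
    simp only [mem_setOf_eq, P]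
    constructor
    · rintro ⟨hx, hv, hvm⟩
      exact ⟨⟨fun i _ => hx i, hv, hvm⟩, hx q⟩
    · rintro ⟨⟨hx, hv, hvm⟩, hq0⟩
      refine ⟨fun i => ?_, hv, hvm⟩
      by_cases hi : (i : ℕ) = (w.take m).sum
      · have : i = q := Fin.ext hi
        rw [this]; exact hq0
      · exact hx i hi
  have hS2 : {z | z ∈ P ∧ z i₀ ∈ Ioo (0:ℝ) 1 ∧ c z < z i₀} =
      {z : Fin ((j + 1) + MZV.weight w) → ℝ |
        (∀ i : Fin (MZV.weight w), z (Fin.natAdd (j + 1) i) ∈ Set.Ioo (0:ℝ) 1) ∧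
        (∀ a : Fin (j + 1), z (Fin.castAdd (MZV.weight w) a) ∈ Set.Ioo (0:ℝ) 1) ∧
        (∀ a b : Fin (j + 1), a < b → z (Fin.castAdd (MZV.weight w) a) < z (Fin.castAdd (MZV.weight w) b)) ∧
        (∀ a : Fin (j + 1), (a : ℕ) + 1 = j + 1 → ∀ i : Fin (MZV.weight w), (i : ℕ) = (w.take m).sum →
          z (Fin.castAdd (MZV.weight w) a) < z (Fin.natAdd (j + 1) i))} := by
    ext z
    simp only [mem_setOf_eq, P, c]
    constructor
    · rintro ⟨⟨hx, hv, hvm⟩, hq0, hcz⟩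
      refine ⟨fun i => ?_, hv, hvm, fun a ha i hi => ?_⟩
      · by_cases hi : (i : ℕ) = (w.take m).sum
        · have : i = q := Fin.ext hi
          rw [this]; exact hq0
        · exact hx i hi
      · have ha' : a = Fin.last j := Fin.ext (by simp; omega)
        have hi' : i = q := Fin.ext hi
        rw [ha', hi']; exact hcz
    · rintro ⟨hx, hv, hvm, htop⟩
      exact ⟨⟨fun i _ => hx i, hv, hvm⟩, hx q, htop (Fin.last j) (by simp) q rfl⟩
  have hσupd : ∀ (cc : ℝ) (x : Fin (MZV.weight w) → ℝ), σ cc x = update x q (cc * x q) := by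
    intro cc x; funext t
    by_cases ht : t = q
    · rw [ht, update_self, hσ, if_pos rfl]
    · rw [update_of_ne ht, hσ, if_neg (fun h => ht (Fin.ext h))]
  have hS3 : ∀ z : Fin ((j + 1) + MZV.weight w) → ℝ,
      (F (fun t => z (Fin.natAdd (j + 1) t)) -
        z (Fin.castAdd (MZV.weight w) (Fin.last j)) *
          F (σ (z (Fin.castAdd (MZV.weight w) (Fin.last j))) (fun t => z (Fin.natAdd (j + 1) t)))) *
        ∏ a : Fin (j + 1), 1 / (1 - z (Fin.castAdd (MZV.weight w) a)) =
      f z - c z * f (update z i₀ (c z * z i₀)) := by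
    intro z
    show _ = F (xz z) * Rz z - c z * (F (xz (update z i₀ (c z * z i₀))) * Rz (update z i₀ (c z * z i₀)))
    rw [hxupd, hRupd, hσupd]
    simp only [xz, c]
    ring
  -- ### the lever
  have hend : ∃ r' : KZ.IntegralRep ((j + 1) + MZV.weight w), r'.domain = {z | z ∈ P ∧ z i₀ ∈ Ioo (0:ℝ) 1} ∧
      EqOn r'.integrand (fun z => f z - c z * f (update z i₀ (c z * z i₀))) r'.domain :=
    ⟨rE, hrEd.trans hS1, fun z hz => by rw [hrEi hz]; exact hS3 z⟩
  obtain ⟨⟨rS, hrSd, hrSi⟩, hlev⟩ :=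
    rider_lever i₀ P hPsa hPupd c f kk hcsa hcupd hc hfsa hksa hder hcont hk0 hend
  refine ⟨⟨rS, hrSd.trans hS2, fun z hz => by rw [hrSi hz]⟩, ?_⟩
  intro r hrd hri
  have h1 : KZ.of r - KZ.of rE ∈ KZ.relations :=
    hlev r rE (hrd.trans hS2.symm) (fun z hz => by rw [hri hz]) (hrEd.trans hS1)
      (fun z hz => by rw [hrEi hz]; exact hS3 z)
  have h2 := hdis rE hrEd hrEi
  have : KZ.of r - ∑ i ∈ Finset.Ico m w.length,
      (C (w.take i ++ [w.getD i 0 + 1] ++ w.drop (i + 1)) i + C (w.take (i + 1) ++ [1] ++ w.drop (i + 1)) (i + 1)) =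
      (KZ.of r - KZ.of rE) + (KZ.of rE - ∑ i ∈ Finset.Ico m w.length,
        (C (w.take i ++ [w.getD i 0 + 1] ++ w.drop (i + 1)) i +
          C (w.take (i + 1) ++ [1] ++ w.drop (i + 1)) (i + 1))) := by abel
  rw [this]
  exact KZ.relations.add_mem h1 h2

end Summit.KontsevichZagierPeriods.FurushoPentagon.DoubleShuffleInKZ
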